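import Literature.AlgebraicGeometry.KTheory.EulerCharOfDerivedIso
import Literature.AlgebraicGeometry.HodgeTheory.ChPerfectZigzag
import HarnessLib

/-!
# `ch_k` of a bounded complex of vector bundles depends only on its class in the derived category

Layer `Literature/AlgebraicGeometry/HodgeTheory` (0 NEW named facts, no instances). The `ch`-twin of `KTheory/EulerCharOfDerivedIso`: the tree's
`chPerfect C X K hK k := chKZero C X k (eulerChar K hK)` (`HodgeTheory/SemiregularVariationalHodgeTwistedPerfect`) factors through the Euler
characteristic in `K₀(X)`, so `IsBoundedVBComplex.eulerChar_eq_of_nonempty_iso_Q` gives at once: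

* `chPerfect_eq_of_nonempty_iso_Q` — on a locally noetherian `X` with `hres` (every coherent module has a strictly perfect resolution, a displayed
  HYPOTHESIS): for bounded VB complexes `K`, `K′` with `Nonempty (DerivedCategory.Q.obj K ≅ DerivedCategory.Q.obj K′)`,
  `chPerfect C X K _ k = chPerfect C X K′ _ k` for every `C : ChernCharacterBetti` and `k`; the `D⁺` variant `chPerfect_eq_of_nonempty_iso_plusQ`;
* `chPerfect_eq_of_nonempty_iso_Q_of_vbModel` / `…_plusQ_of_vbModel` — on a complex abelian variety, under [SP]
  `ThomasonTrobaugh_vbModel_of_boundedCoh` ONLY.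

This completes the honest scope of `HodgeTheory/ChPerfectZigzag` (`chPerfect_eq_of_roof` / `_coroof`: zigzags THROUGH bounded VB complexes): two
bounded vector-bundle models of ONE object of `D(Mod 𝒪_X)` (resp. `D⁺`) have the same `ch_k`, with no chain-level zigzag between them required.
Research route conditional on HC_CM; not a corollary; nothing here refers to it.

## References

* W. Fulton, *Intersection Theory*, 2nd ed. (1998), §15.1 (Chern character of perfect complexes), App. B.8.3. [Fulton1998]
* M. Schlichting, *Higher algebraic K-theory*, LNM 2008 (2011), Exercise 3.1.4. [Schlichting2011HigherKTheory]
* P. Berthelot, A. Grothendieck, L. Illusie, *SGA 6*, Exp. IV §2. [SGA6]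
* R. W. Thomason, T. Trobaugh, *Higher algebraic K-theory of schemes and of derived categories* (1990), Prop. 2.3.1 (d). [ThomasonTrobaugh1990]
-/

noncomputable section

universe w

open CategoryTheory CategoryTheory.Limits AlgebraicGeometry

namespace Literature.AlgebraicGeometry.HodgeTheory

open Literature.AlgebraicGeometry.Motives Literature.AlgebraicGeometry.KTheory Literature.AlgebraicGeometry.Modules
  Literature.AlgebraicGeometry.Morphisms

variable (C : ChernCharacterBetti) (X : SchemeOver ℂ)

/-- **`ch_k(K) = ch_k(K′)` for bounded complexes of vector bundles with isomorphic classes in `D(Mod 𝒪_X)`** (under `hres`, `X` locally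
noetherian; every `C : ChernCharacterBetti`, every `k`). [cite: Fulton1998, §15.1] [cite: Schlichting2011HigherKTheory, Exercise 3.1.4]
[cite: SGA6, Exp. IV §2] -/
theorem chPerfect_eq_of_nonempty_iso_Q [IsLocallyNoetherian X.left]
    (hres : ∀ G : X.left.Modules, Coh G → Nonempty (StrictlyPerfectResolution G)) [HasDerivedCategory.{w} X.left.Modules]
    {K K' : CochainComplex X.left.Modules ℤ} (hK : IsBoundedVBComplex K) (hK' : IsBoundedVBComplex K')
    (e : Nonempty (DerivedCategory.Q.obj K ≅ DerivedCategory.Q.obj K')) (k : ℕ) :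
    chPerfect C X K hK.isFiniteLocallyFree k = chPerfect C X K' hK'.isFiniteLocallyFree k := by
  rw [chPerfect, chPerfect, hK.eulerChar_eq_of_nonempty_iso_Q hres hK' e]

/-- **`D⁺` variant**: bounded VB complexes whose classes `Plus.Q.obj ⟨K, n, _⟩ ≅ Plus.Q.obj ⟨K′, n′, _⟩` agree in the bounded-below derived category
have the same `ch_k`. [cite: Fulton1998, §15.1] [cite: Schlichting2011HigherKTheory, Exercise 3.1.4] -/
theorem chPerfect_eq_of_nonempty_iso_plusQ [IsLocallyNoetherian X.left]
    (hres : ∀ G : X.left.Modules, Coh G → Nonempty (StrictlyPerfectResolution G)) [HasDerivedCategory.{w} X.left.Modules]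
    {K K' : CochainComplex X.left.Modules ℤ} (hK : IsBoundedVBComplex K) (hK' : IsBoundedVBComplex K') {n n' : ℤ}
    (hn : K.IsStrictlyGE n) (hn' : K'.IsStrictlyGE n')
    (e : Nonempty (DerivedCategory.Plus.Q.obj ⟨K, n, hn⟩ ≅ DerivedCategory.Plus.Q.obj ⟨K', n', hn'⟩)) (k : ℕ) :
    chPerfect C X K hK.isFiniteLocallyFree k = chPerfect C X K' hK'.isFiniteLocallyFree k := by
  rw [chPerfect, chPerfect, hK.eulerChar_eq_of_nonempty_iso_plusQ hres hK' hn hn' e]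

/-- **On a complex abelian variety, `ch_k` of a bounded VB complex depends only on its derived class** — under [SP]
`ThomasonTrobaugh_vbModel_of_boundedCoh` ONLY. [cite: ThomasonTrobaugh1990, Prop. 2.3.1 (d)] [cite: Fulton1998, §15.1] -/
theorem chPerfect_eq_of_nonempty_iso_Q_of_vbModel (hSP : ThomasonTrobaugh_vbModel_of_boundedCoh.{w}) (B : AbelianVariety ℂ)
    [HasDerivedCategory.{w} B.X.left.Modules] {K K' : CochainComplex B.X.left.Modules ℤ}
    (hK : IsBoundedVBComplex K) (hK' : IsBoundedVBComplex K') (e : Nonempty (DerivedCategory.Q.obj K ≅ DerivedCategory.Q.obj K')) (k : ℕ) :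
    chPerfect C B.X K hK.isFiniteLocallyFree k = chPerfect C B.X K' hK'.isFiniteLocallyFree k := by
  rw [chPerfect, chPerfect, hK.eulerChar_eq_of_nonempty_iso_Q_of_vbModel hSP B hK' e]

/-- **`D⁺` variant on a complex abelian variety** (the form in which vector-bundle models of descended transforms are produced: an iso of
`DerivedCategory.Plus` classes). [cite: ThomasonTrobaugh1990, Prop. 2.3.1 (d)] [cite: Fulton1998, §15.1] -/
theorem chPerfect_eq_of_nonempty_iso_plusQ_of_vbModel (hSP : ThomasonTrobaugh_vbModel_of_boundedCoh.{w}) (B : AbelianVariety ℂ)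
    [HasDerivedCategory.{w} B.X.left.Modules] {K K' : CochainComplex B.X.left.Modules ℤ}
    (hK : IsBoundedVBComplex K) (hK' : IsBoundedVBComplex K') {n n' : ℤ} (hn : K.IsStrictlyGE n) (hn' : K'.IsStrictlyGE n')
    (e : Nonempty (DerivedCategory.Plus.Q.obj ⟨K, n, hn⟩ ≅ DerivedCategory.Plus.Q.obj ⟨K', n', hn'⟩)) (k : ℕ) :
    chPerfect C B.X K hK.isFiniteLocallyFree k = chPerfect C B.X K' hK'.isFiniteLocallyFree k := by
  rw [chPerfect, chPerfect, hK.eulerChar_eq_of_nonempty_iso_plusQ_of_vbModel hSP B hK' hn hn' e]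

end Literature.AlgebraicGeometry.HodgeTheory

end
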